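import Summits.FinalStateConjecture.FinalStateConjecture.Theses.StarvedNecks
import Literature.Geometry.Lorentzian.CausalityPushUp

/-!
# Route StarvedNecks — crux `NecksCertify`, line `two-cap-focusing-ledger`: rung N1a′₀ (hole-free analysis certificate)

Registered stub `stub_neckLedgerAnalysisZero` of the line skeleton (v5,
`Cruxes/NecksCertify/Lines/two_cap_focusing_ledger.lean`): for an honest `C⁴` final-state
decomposition `d` of the exterior `O = exteriorOf 𝒟 d.charted` of an admissible MGHD WITHOUT black
holes (`d.N = 0`), the drift-free analysis certificate `NeckCertificate 𝒟 O d R₀` holds.  With no hole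
every clause of the certificate quantified over `Fin d.N` is vacuous; what remains is its causal
covering clause K12 for the input's own flat chart `Φ`:

  for every flat time `T > τ₀`, every point of `O` outside `Φ''{y⁰ > T}` lies in the causal past of
  the flat slab `Φ''{y⁰ = T}`.

Proof (typed causal bookkeeping, no analysis).  `O ⊆ I⁻(Φ''{y⁰ > τ₀})` because the charted region
of a hole-free decomposition is its radiation zone; so a point `p ∈ O` is chronologically below some
flat-late point `Φ y`.  If `y⁰ < T`, `Φ y` is causally below the slab by `HonestFar`(1) and push-up
(`x ≪ y ≤ z ⇒ x ≪ z`, O'Neill 1983, Cor. 14.1, for the reversed time orientation) puts `p` in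
`I⁻ ⊆ J⁻` of the slab; if `y⁰ = T`, `Φ y` is on the slab.  If `y⁰ > T`, follow the witnessing
(past-directed) timelike curve from `Φ y` to `p`: its FIRST EXIT parameter from the open set
`W = Φ''{y⁰ > T}` (the image of an open subset of the late region under an open embedding) gives a
point of the curve outside `W` but in `closure W ⊆ closure Φ''{y⁰ ≥ T} ⊆ Φ''{y⁰ ≥ T}` — the last
inclusion is `HonestFar`(2), whose hole conjunct is vacuous at `N = 0` — hence ON the slab, and the
rest of the curve exhibits `p` in the causal past of that point.

The statement is the registered signature with the three `Prop` bundles of the line skeleton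
(`HonestCore`, `HonestFar`, `NeckCertificate` K1–K12) inlined verbatim as `let`s.

References: B. O'Neill, *Semi-Riemannian geometry*, Academic Press 1983, Ch. 14, Cor. 14.1 and
pp. 402–403; M. Dafermos, G. Holzegel, I. Rodnianski, M. Taylor, arXiv:2104.08222, §1 (late-time
charts).  Mathlib + `Literature.Geometry.Lorentzian.{KerrConvergence, FinalState, CausalityPushUp}`;
no definitions, no named facts.
-/

noncomputable section

open scoped Manifold ContDiff Topology ENNReal
open Filter Set MeasureTheory Topology Literature.Geometry.Lorentzian

namespace Summit.FinalStateConjecture.FinalStateConjecture.Theorems.NecksCertifyTwoCap.AnalysisZero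

set_option linter.dupNamespace false -- `FinalStateConjecture.FinalStateConjecture` is the D-0017 summit/problem layout

/-! ## Two topological lemmas -/

/-- **First exit of a path from an open set.**  If `γ` is continuous on `[a, b]`, `γ a ∈ W` with `W`
open and `γ b ∉ W`, then some parameter `s ∈ (a, b]` has `γ s ∉ W` but `γ s ∈ closure W` (take
`s = inf {t ∈ [a, b] | γ t ∉ W}`; the points before `s` are mapped into `W`). [folklore] -/
theorem exists_firstExit_of_continuousOn {M : Type*} [TopologicalSpace M] {γ : ℝ → M} {a b : ℝ}
    (hab : a ≤ b) (hγ : ContinuousOn γ (Icc a b)) {W : Set M} (hW : IsOpen W) (ha : γ a ∈ W)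
    (hb : γ b ∉ W) :
    ∃ s, a < s ∧ s ≤ b ∧ γ s ∉ W ∧ γ s ∈ closure W := by
  set A : Set ℝ := Icc a b ∩ γ ⁻¹' Wᶜ with hA
  have hAc : IsClosed A := hγ.preimage_isClosed_of_isClosed isClosed_Icc hW.isClosed_compl
  have hbA : b ∈ A := ⟨right_mem_Icc.mpr hab, hb⟩
  have hAne : A.Nonempty := ⟨b, hbA⟩
  have hAbdd : BddBelow A := ⟨a, fun x hx ↦ hx.1.1⟩
  have hsA : sInf A ∈ A := hAc.csInf_mem hAne hAbdd
  have hsb : sInf A ≤ b := csInf_le hAbdd hbA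
  have has : a ≤ sInf A := hsA.1.1
  have has' : a < sInf A := by
    refine lt_of_le_of_ne has fun h ↦ ?_
    have : γ (sInf A) ∉ W := hsA.2
    rw [← h] at this
    exact this ha
  refine ⟨sInf A, has', hsb, hsA.2, ?_⟩
  have hin : ∀ t ∈ Ico a (sInf A), γ t ∈ W := by
    intro t ht
    by_contra hcon
    have htA : t ∈ A := ⟨⟨ht.1, ht.2.le.trans hsb⟩, hcon⟩
    exact (not_lt.mpr (csInf_le hAbdd htA)) ht.2
  have hcont : ContinuousWithinAt γ (Ico a (sInf A)) (sInf A) :=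
    (hγ (sInf A) hsA.1).mono fun t ht ↦ ⟨ht.1, ht.2.le.trans hsb⟩
  haveI : (𝓝[Ico a (sInf A)] (sInf A)).NeBot := by
    rw [nhdsWithin_Ico_eq_nhdsLT has']
    infer_instance
  exact mem_closure_of_tendsto hcont (eventually_mem_nhdsWithin.mono hin)

/-- Images of open subsets of the late region under a late chart are open (the chart restricted to
the late region is an open embedding); local copy of
`…Theorems.SeamedChartsExhaust.WideAnchoring.isOpen_image_of_isLateChart` (not in this file's import
cone). [folklore] -/
private theorem isOpen_image_of_isLateChart' {𝓢 : Spacetime.{0} 4} {B : ModelBackground}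
    {𝒟 : Set 𝓢.carrier} {τ₀ : ℝ} {Ψ : B.domain → 𝓢.carrier} (hΨ : 𝓢.IsLateChart B 𝒟 τ₀ Ψ)
    {U : Set B.domain} (hU : IsOpen U) (hUl : U ⊆ B.lateRegion τ₀) : IsOpen (Ψ '' U) := by
  have h := hΨ.isOpenEmbedding.isOpenMap (Subtype.val ⁻¹' U) (hU.preimage continuous_subtype_val)
  have hEq : (B.lateRegion τ₀).restrict Ψ '' (Subtype.val ⁻¹' U) = Ψ '' U := by
    ext z
    constructor
    · rintro ⟨⟨x, hxl⟩, hxU, rfl⟩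
      exact ⟨x, hxU, rfl⟩
    · rintro ⟨x, hxU, rfl⟩
      exact ⟨⟨x, hUl hxU⟩, hxU, rfl⟩
  rw [← hEq]
  exact h

/-! ## The covering clause of a hole-free honest decomposition -/

/-- **Flat covering at every late threshold.**  For a final-state decomposition `d` of `O` with
`O ⊆ I⁻(Φ''{y⁰ > τ₀})` (no hole: the charted region is the radiation zone), flat-late points below
later flat slabs (`HonestFar`(1)) and closed late flat images (`HonestFar`(2) at `N = 0`): for every
`T > τ₀`, `O ∖ Φ''{y⁰ > T} ⊆ J⁻(Φ''{y⁰ = T})`.  O'Neill 1983, Ch. 14, Cor. 14.1 (push-up) and the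
first-exit argument of the module docstring. [folklore] -/
theorem flatCovering_of_noHole {𝓢 : Spacetime.{0} 4} {O : Set 𝓢.carrier} {k : ℕ}
    (d : FinalStateDecomposition 𝓢 O k)
    (hOI : O ⊆ 𝓢.metric.chronologicalPast 𝓢.timeOrientation
      (d.flatChart '' (Minkowski.backgroundOn d.flatDomain).lateRegion d.τ₀))
    (hf1 : ∀ τ₂ : ℝ, d.τ₀ < τ₂ → d.flatChart '' {y | d.τ₀ < y.1 0 ∧ y.1 0 < τ₂} ⊆
      𝓢.metric.causalPast 𝓢.timeOrientation
        (d.flatChart '' (Minkowski.backgroundOn d.flatDomain).timeSlab τ₂))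
    (hf2 : ∀ τ' : ℝ, d.τ₀ < τ' → closure (d.flatChart '' {y | τ' ≤ y.1 0}) ⊆
      d.flatChart '' {y | τ' ≤ y.1 0})
    {T : ℝ} (hT : d.τ₀ < T) :
    O \ d.flatChart '' {y | T < y.1 0} ⊆
      𝓢.metric.causalPast 𝓢.timeOrientation (d.flatChart '' {y | y.1 0 = T}) := by
  intro p hp
  obtain ⟨hpO, hpW⟩ := hp
  -- `p ≪ Φ y` with `y` flat-late, witnessed by a past-directed timelike curve `γ : [a, b] → M`
  have hpI : p ∈ 𝓢.metric.chronologicalFuture 𝓢.timeOrientation.reverse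
      (d.flatChart '' (Minkowski.backgroundOn d.flatDomain).lateRegion d.τ₀) := hOI hpO
  obtain ⟨q, ⟨y, hy, rfl⟩, γ, a, b, hab, hγ, hγa, hγb⟩ := hpI
  have hy' : d.τ₀ < y.1 0 := hy
  have hn1 : (1 : WithTop ℕ∞) ≤ ((⊤ : ℕ∞) : WithTop ℕ∞) := WithTop.coe_le_coe.mpr le_top
  -- the slab `S` and the open late set `W`
  set S : Set 𝓢.carrier := d.flatChart '' {y | y.1 0 = T} with hSdef
  set W : Set 𝓢.carrier := d.flatChart '' {y | T < y.1 0} with hWdef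
  show p ∈ 𝓢.metric.causalFuture 𝓢.timeOrientation.reverse S
  -- from `p ≪ z` with `z ∈ S`, conclude
  have concl : ∀ z ∈ S, p ∈ 𝓢.metric.chronologicalFuture 𝓢.timeOrientation.reverse {z} →
      p ∈ 𝓢.metric.causalFuture 𝓢.timeOrientation.reverse S := fun z hz hpz ↦
    LorentzianMetric.chronologicalFuture_subset_causalFuture _ _ S
      (LorentzianMetric.chronologicalFuture_mono (singleton_subset_iff.mpr hz) hpz)
  rcases lt_trichotomy (y.1 0) T with hlt | heq | hgt
  · -- `Φ y ≤ Φ z` with `z⁰ = T` (`HonestFar`(1)), then push-up `p ≪ Φ y ≤ Φ z`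
    have h1 := hf1 T hT ⟨y, ⟨hy', hlt⟩, rfl⟩
    have h1' : d.flatChart y ∈ 𝓢.metric.causalFuture 𝓢.timeOrientation.reverse S := h1
    rw [LorentzianMetric.causalFuture_eq_biUnion] at h1'
    simp only [Set.mem_iUnion, exists_prop] at h1'
    obtain ⟨z, hz, hyz⟩ := h1'
    have hpq : p ∈ 𝓢.metric.chronologicalFuture 𝓢.timeOrientation.reverse {d.flatChart y} :=
      ⟨d.flatChart y, rfl, γ, a, b, hab, hγ, hγa, hγb⟩
    exact concl z hz (LorentzianMetric.mem_chronologicalFuture_of_mem_causalFuture hn1 hyz hpq)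
  · -- `Φ y` is on the slab
    exact concl (d.flatChart y) ⟨y, heq, rfl⟩ ⟨d.flatChart y, rfl, γ, a, b, hab, hγ, hγa, hγb⟩
  · -- first exit of `γ` from the open set `W`
    have hWopen : IsOpen W := by
      refine isOpen_image_of_isLateChart' d.isLateChart_flat ?_ fun z hz ↦ hT.trans hz
      have h0 : Continuous fun z : E4 ↦ z 0 := PiLp.continuous_apply 2 _ 0
      exact isOpen_lt continuous_const (h0.comp continuous_subtype_val)
    have hγcont : ContinuousOn γ (Icc a b) := fun t ht ↦
      (hγ.isFutureCausalCurveOn.continuousAt ht).continuousWithinAt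
    have hγaW : γ a ∈ W := by rw [hγa]; exact ⟨y, hgt, rfl⟩
    have hγbW : γ b ∉ W := by rw [hγb]; exact hpW
    obtain ⟨s, has, hsb, hsW, hscl⟩ :=
      exists_firstExit_of_continuousOn hab.le hγcont hWopen hγaW hγbW
    -- `closure W ⊆ Φ''{y⁰ ≥ T}` (`HonestFar`(2)), so `γ s` is a flat point with `y⁰ ≥ T`, not `> T`
    have hsub : ({y | T < y.1 0} : Set d.flatDomain) ⊆ {y | T ≤ y.1 0} :=
      fun z (hz : T < z.1 0) ↦ show T ≤ z.1 0 from hz.le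
    have hcl : closure W ⊆ d.flatChart '' {y | T ≤ y.1 0} :=
      (closure_mono (Set.image_mono hsub)).trans (hf2 T hT)
    obtain ⟨z, hz, hzs⟩ := hcl hscl
    have hzT : z.1 0 = T := by
      rcases (show T ≤ z.1 0 from hz).eq_or_lt with h | h
      · exact h.symm
      · exact (hsW ⟨z, h, hzs⟩).elim
    have hzS : γ s ∈ S := ⟨z, hzT, hzs⟩
    rcases hsb.eq_or_lt with h | h
    · -- `s = b`: `p = γ b` is on the slab
      rw [h, hγb] at hzS
      exact LorentzianMetric.subset_causalFuture _ _ S hzS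
    · -- `s < b`: the rest of `γ` is a past-directed timelike curve from `γ s ∈ S` to `p`
      exact concl (γ s) hzS ⟨γ s, rfl, γ, s, b, h,
        hγ.mono (Icc_subset_Icc has.le le_rfl), rfl, hγb⟩


/-- Registered helper sub-goal `stub_neckLedgerAnalysisZero_flatCovering` (anchor of this file on the
crux item): the flat covering at every late threshold, `flatCovering_of_noHole` in closed `∀` form.
O'Neill 1983, Ch. 14, Cor. 14.1. [folklore] -/
theorem stub_neckLedgerAnalysisZero_flatCovering : ∀ (𝓢 : Spacetime.{0} 4) (O : Set 𝓢.carrier) (k : ℕ) (d : FinalStateDecomposition 𝓢 O k), O ⊆ 𝓢.metric.chronologicalPast 𝓢.timeOrientation (d.flatChart '' (Minkowski.backgroundOn d.flatDomain).lateRegion d.τ₀) → (∀ τ₂ : ℝ, d.τ₀ < τ₂ → d.flatChart '' {y | d.τ₀ < y.1 0 ∧ y.1 0 < τ₂} ⊆ 𝓢.metric.causalPast 𝓢.timeOrientation (d.flatChart '' (Minkowski.backgroundOn d.flatDomain).timeSlab τ₂)) → (∀ τ' : ℝ, d.τ₀ < τ' → closure (d.flatChart '' {y | τ' ≤ y.1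 0}) ⊆ d.flatChart '' {y | τ' ≤ y.1 0}) → ∀ T : ℝ, d.τ₀ < T → O \ d.flatChart '' {y | T < y.1 0} ⊆ 𝓢.metric.causalPast 𝓢.timeOrientation (d.flatChart '' {y | y.1 0 = T}) :=
  fun _ _ _ d hOI hf1 hf2 _ hT ↦ flatCovering_of_noHole d hOI hf1 hf2 hT

/-! ## The registered stub -/

/-- **N1a′₀ — the analysis certificate of a hole-free honest input** (registered stub
`stub_neckLedgerAnalysisZero` of the line `two-cap-focusing-ledger`, v5; bundles `HonestCore`,
`HonestFar`, `NeckCertificate` inlined verbatim as `let`s).  For `d.N = 0` every clause of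
`NeckCertificate` over `Fin d.N` is vacuous (witnesses `R₁ := R₀`, `τ₁ := τ₀`, trivial radii, no
re-gauged chart) and the covering clause K12 is `flatCovering_of_noHole` (`O ⊆ I⁻(radiation zone)`
from `O = exteriorOf 𝒟 d.charted`, `HonestFar`(1), `HonestFar`(2)).  O'Neill 1983, Ch. 14,
Cor. 14.1; DHRT arXiv:2104.08222, §1. [folklore] -/
theorem stub_neckLedgerAnalysisZero :
    let HonestCore := fun (𝓢 : Spacetime.{0} 4) (O : Set 𝓢.carrier) (k : ℕ)
        (d : FinalStateDecomposition 𝓢 O k) (R₀ : ℝ) ↦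
      let B := d.background; let t := fun i ↦ (B i).time; let r := fun i ↦ (B i).radius; let Ψ := d.chart;
      (∀ i, Kerr.IsSubextremal (d.mass i) (d.spin i) ∧ 100 * d.mass i ≤ R₀ ∧ 0 < ((d.motion i).1 : E4 ≃L[ℝ] E4) (E4.basisVector 0) 0) ∧
        (∀ i (ϱ τ₂ : ℝ), R₀ ≤ ϱ → d.τ₀ < τ₂ → Ψ i '' {x | d.τ₀ < t i x.1 ∧ t i x.1 < τ₂ ∧ r i x.1 < ϱ} ⊆ 𝓢.metric.causalPast 𝓢.timeOrientation (Ψ i '' (B i).truncTimeSlab ϱ τ₂)) ∧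
        (∀ i (τ' : ℝ) (ϱ : ℝ → ℝ), Continuous ϱ → d.τ₀ < τ' → let A := Ψ i '' {x | τ' ≤ t i x.1 ∧ r i x.1 ≤ ϱ (t i x.1)}; closure A ∩ O ⊆ A) ∧
        (∀ y : d.flatDomain, d.τ₀ < y.1 0 → 𝓢.timeOrientation.IsFutureDirected (mfderiv 𝓘(ℝ, E4) (𝓡 4) d.flatChart y (E4.basisVector 0)))
    let HonestFar := fun (𝓢 : Spacetime.{0} 4) (O : Set 𝓢.carrier) (k : ℕ)
        (d : FinalStateDecomposition 𝓢 O k) (R₀ : ℝ) ↦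
      let B := d.background; let t := fun i ↦ (B i).time; let r := fun i ↦ (B i).radius; let Φ := d.flatChart;
      (∀ τ₂ : ℝ, d.τ₀ < τ₂ → Φ '' {y | d.τ₀ < y.1 0 ∧ y.1 0 < τ₂} ⊆ 𝓢.metric.causalPast 𝓢.timeOrientation (Φ '' (Minkowski.backgroundOn d.flatDomain).timeSlab τ₂)) ∧
        (∀ τ' : ℝ, d.τ₀ < τ' → closure (Φ '' {y | τ' ≤ y.1 0 ∧ ∀ i, d.excision i (y.1 0) + 1 ≤ r i y.1}) ⊆ Φ '' {y | τ' ≤ y.1 0}) ∧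
        (∀ i, ∃ T : ℝ, supCkENorm (Subtype.val '' {x : (B i).domain | T ≤ t i x.1 ∧ R₀ ≤ r i x.1 ∧ ∀ j, j ≠ i → r i x.1 ≤ r j x.1}) 0 (𝓢.deviationExtend (B i) (d.chart i)) ≤ ENNReal.ofReal (1 / (10 * ‖(((d.motion i).1 : E4 ≃L[ℝ] E4) : E4 →L[ℝ] E4)‖ ^ 2)))
    let NeckCertificate := fun (𝓢 : Spacetime.{0} 4) (O : Set 𝓢.carrier)
        (d : FinalStateDecomposition 𝓢 O 4) (R₀ : ℝ) ↦
      let B := d.background; let t := fun i ↦ (B i).time; let r := fun i ↦ (B i).radius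
      let Λ := fun i ↦ ((d.motion i).1 : E4 ≃L[ℝ] E4); let Φ := d.flatChart; let Ψ := d.chart
      let ρ := d.excision
      ∃ (R₁ τ₁ : ℝ) (ρa Rc : Fin d.N → ℝ → ℝ) (Ψa : ∀ i, (B i).domain → 𝓢.carrier),
        R₀ ≤ R₁ ∧ d.τ₀ ≤ τ₁ ∧
        -- K1: analysis walls (flat-time indexed)
        (∀ i, Monotone (ρa i) ∧ Continuous (ρa i) ∧ Tendsto (fun s ↦ ρa i s / s) atTop (𝓝 0) ∧
          Tendsto (ρa i) atTop atTop ∧ ∀ s, R₁ + 1 ≤ ρa i s ∧ (τ₁ ≤ s → ρ i s + 1 ≤ ρa i s)) ∧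
        -- K2: certified radii (hole-time indexed), exhausting every radius
        (∀ i, Monotone (Rc i) ∧ Continuous (Rc i) ∧ Tendsto (fun s ↦ Rc i s / s) atTop (𝓝 0) ∧
          Tendsto (Rc i) atTop atTop ∧ ∀ s, R₁ + 4 ≤ Rc i s) ∧
        -- K3: the certified tubes swallow the analysis region with margin 3
        (∀ j (y : E4), τ₁ ≤ y 0 → r j y ≤ 9 * ρa j (y 0) → r j y + 3 ≤ Rc j (t j y)) ∧
        -- K4: the re-gauged charts on the late tubes
        (∀ i, let U : Set (B i).domain := {x | τ₁ < t i x.1 ∧ r i x.1 < Rc i (t i x.1) + 2}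
          ContMDiffOn 𝓘(ℝ, E4) (𝓡 4) ∞ (Ψa i) U ∧ IsOpenEmbedding (U.restrict (Ψa i)) ∧
            Ψa i '' U ⊆ d.charted) ∧
        -- K5: near zone untouched
        (∀ i (x : (B i).domain), r i x.1 ≤ R₁ + 1 → Ψa i x = Ψ i x) ∧
        -- K6: ONE ATLAS on the whole analysis collar `4ρa ≤ rᵢ ≤ Rc + 2` (flat-late)
        (∀ i (y : E4) (hy : y ∈ (B i).domain), τ₁ ≤ y 0 → 4 * ρa i (y 0) ≤ r i y →
          r i y ≤ Rc i (t i y) + 2 → ∃ hy' : y ∈ d.flatDomain, Ψa i ⟨y, hy⟩ = Φ ⟨y, hy'⟩) ∧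
        -- K7: C² certification out to Rc (the analytic content)
        (∀ i, Tendsto (fun τ ↦ 𝓢.truncDeviationCk (B i) (Ψa i) 2 (Rc i τ) τ) atTop (𝓝 0)) ∧
        -- K8/K9: C⁰ honesty and future-directed hole time-lines on `R₁ ≤ rᵢ ≤ Rc + 2`
        (∀ i, supCkENorm (Subtype.val '' {x : (B i).domain | τ₁ ≤ t i x.1 ∧ R₁ ≤ r i x.1 ∧
            r i x.1 ≤ Rc i (t i x.1) + 2}) 0 (𝓢.deviationExtend (B i) (Ψa i)) ≤
          ENNReal.ofReal (1 / (10 * ‖(Λ i : E4 →L[ℝ] E4)‖ ^ 2))) ∧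
        (∀ i (x : (B i).domain), τ₁ ≤ t i x.1 → R₁ ≤ r i x.1 → r i x.1 ≤ Rc i (t i x.1) + 2 →
          𝓢.timeOrientation.IsFutureDirected
            (mfderiv 𝓘(ℝ, E4) (𝓡 4) (Ψa i) x ((Λ i) (E4.basisVector 0)))) ∧
        -- K10: images of different holes' late tubes are disjoint
        (∀ i j, i ≠ j → Disjoint (Ψa i '' {x | τ₁ < t i x.1 ∧ r i x.1 < Rc i (t i x.1) + 2})
          (Ψa j '' {x | τ₁ < t j x.1 ∧ r j x.1 < Rc j (t j x.1) + 2})) ∧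
        -- K11: late tube portions (continuous profiles below Rc + 2) are relatively closed in O
        (∀ i (τ' : ℝ) (ϱ : ℝ → ℝ), Continuous ϱ → τ₁ < τ' → (∀ s, ϱ s < Rc i s + 2) →
          closure (Ψa i '' {x | τ' ≤ t i x.1 ∧ r i x.1 ≤ ϱ (t i x.1)}) ∩ O ⊆
            Ψa i '' {x | τ' ≤ t i x.1 ∧ r i x.1 ≤ ϱ (t i x.1)}) ∧
        -- K12: causal covering by the analysis atlas, for every COMPATIBLE choice of late thresholds
        (∀ (T : ℝ) (Th : Fin d.N → ℝ), τ₁ < T → (∀ j, τ₁ < Th j) →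
          (∀ j (y : E4), T < y 0 → r j y ≤ Rc j (t j y) + 2 → Th j < t j y) →
          O \ (Φ '' {y | T < y.1 0 ∧ ∀ j, 5 * ρa j (y.1 0) < r j y.1} ∪
              ⋃ j, Ψa j '' {x | Th j < t j x.1 ∧ r j x.1 < Rc j (t j x.1) + 2}) ⊆
            𝓢.metric.causalPast 𝓢.timeOrientation
              (Φ '' {y | y.1 0 = T ∧ ∀ j, 5 * ρa j (y.1 0) < r j y.1} ∪
                ⋃ j, Ψa j '' {x | t j x.1 = Th j ∧ r j x.1 < Rc j (t j x.1) + 2}))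
    ∀ (X : Type) [TopologicalSpace X] [ChartedSpace E3 X] [IsManifold (𝓡 3) ∞ X] [ConnectedSpace X]
      (D : InitialDataSet (𝓡 3) X), D ∈ admissibleVacuumData X →
      ∀ 𝒟 : VacuumCauchyDevelopment D, 𝒟.IsMaximal →
      ∀ (O : Set 𝒟.carrier) (d : FinalStateDecomposition 𝒟.toSpacetime O 4) (R₀ : ℝ),
        O = exteriorOf 𝒟.toCauchyDevelopment d.charted →
        HonestCore 𝒟.toSpacetime O 4 d R₀ → HonestFar 𝒟.toSpacetime O 4 d R₀ → d.N = 0 →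
        NeckCertificate 𝒟.toSpacetime O d R₀ := by
  intro HonestCore HonestFar NeckCertificate X _ _ _ _ D _ 𝒟 _ O d R₀ hO _ hf hN
  obtain ⟨hf1, hf2, -⟩ := hf
  haveI hE : IsEmpty (Fin d.N) := by rw [hN]; infer_instance
  -- `O ⊆ I⁻(radiation zone)`: the charted region of a hole-free decomposition is its radiation zone
  have hch : d.charted = d.flatChart '' (Minkowski.backgroundOn d.flatDomain).lateRegion d.τ₀ := by
    rw [FinalStateDecomposition.charted, Set.iUnion_of_empty, Set.union_empty]; rfl
  have hOI : O ⊆ 𝒟.toSpacetime.metric.chronologicalPast 𝒟.toSpacetime.timeOrientation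
      (d.flatChart '' (Minkowski.backgroundOn d.flatDomain).lateRegion d.τ₀) := by
    intro p hp
    rw [hO, hch] at hp
    exact hp.2
  -- `HonestFar`(2) without its (vacuous) hole conjunct
  have hf2' : ∀ τ' : ℝ, d.τ₀ < τ' → closure (d.flatChart '' {y | τ' ≤ y.1 0}) ⊆
      d.flatChart '' {y | τ' ≤ y.1 0} := by
    intro τ' hτ'
    have h := hf2 τ' hτ'
    have e : {y : d.flatDomain | τ' ≤ y.1 0 ∧ ∀ i : Fin d.N,
        d.excision i (y.1 0) + 1 ≤ (d.background i).radius y.1} = {y | τ' ≤ y.1 0} := by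
      ext y; simp only [Set.mem_setOf_eq, IsEmpty.forall_iff, and_true]
    rwa [e] at h
  refine ⟨R₀, d.τ₀, fun _ _ ↦ 0, fun _ _ ↦ 0, fun i ↦ (hE.false i).elim, le_rfl, le_rfl,
    fun i ↦ (hE.false i).elim, fun i ↦ (hE.false i).elim, fun j ↦ (hE.false j).elim,
    fun i ↦ (hE.false i).elim, fun i ↦ (hE.false i).elim, fun i ↦ (hE.false i).elim,
    fun i ↦ (hE.false i).elim, fun i ↦ (hE.false i).elim, fun i ↦ (hE.false i).elim,
    fun i ↦ (hE.false i).elim, fun i ↦ (hE.false i).elim, ?_⟩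
  -- K12 (no hole): the flat covering at every threshold `T > τ₀`
  intro T Th hT _ _
  rw [Set.iUnion_of_empty, Set.union_empty, Set.iUnion_of_empty, Set.union_empty]
  have e1 : {y : d.flatDomain | T < y.1 0 ∧ ∀ j : Fin d.N,
      5 * (0 : ℝ) < (d.background j).radius y.1} = {y | T < y.1 0} := by
    ext y; simp only [Set.mem_setOf_eq, IsEmpty.forall_iff, and_true]
  have e2 : {y : d.flatDomain | y.1 0 = T ∧ ∀ j : Fin d.N,
      5 * (0 : ℝ) < (d.background j).radius y.1} = {y | y.1 0 = T} := by
    ext y; simp only [Set.mem_setOf_eq, IsEmpty.forall_iff, and_true]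
  rw [e1, e2]
  exact flatCovering_of_noHole d hOI hf1 hf2' hT

end Summit.FinalStateConjecture.FinalStateConjecture.Theorems.NecksCertifyTwoCap.AnalysisZero

end
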